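import Summits.CriticalPhenomena.PercolationContinuityZ3.Theorems.Transplant.GrigorchukSectionsDefs
import Summits.CriticalPhenomena.PercolationContinuityZ3.Theorems.Transplant.GrigorchukNormalForms
import Mathlib.Data.Fin.VecNotation
import HarnessLib

/-!
# A COMPUTABLE finite-level model of the Grigorchuk generators, the bridge to `genA … genD`, and `ne_one_of_moves`: certified NON-identities of
# words in `𝔊` by `decide` on finite binary words

builds on p205010 (kernel theorem, internal audit signed; external expert review pending) — nothing in this file uses p205010; pure group theory /
combinatorics about the tree's first Grigorchuk group `𝔊 = ⟨a, b, c, d⟩ ≤ Perm({0,1}^ℕ)` («GrigorchukLamplighterDefs» p581401, «GrigorchukSectionsDefs»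
p590401), no percolation statement, nothing about any `@[conjecture]`.  Lane `prim-bschramm`, seat `prim-bschramm-p3` gen 36 (DESIGN OWNER;
`P3-NILPOTENT.md` §29.1).  Helper file (`--supports stmt-CriticalPhenomena-4575 --as helper`).  No new copy of `𝔊`: the model is a function on
`List Bool`, and the bridge (`trunc_evalPerm`) says it computes the level-`n` TRUNCATION of the tree's own `genA, genB, genC, genD`.

WHY.  The label-rigidity census of `Cay(ℤ ≀_X 𝔊; a,b,c,d,s)` («GrigorchukLamplighterLabelRigidity», to come) needs finitely many NON-identities of explicit
words in `𝔊` (54 alternating words of length 8, 128 of length 16, and a handful of short ones).  The SOUND direction only is used (refuter condition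
(2a), lead g25 ruling O14): a word whose finite model MOVES some binary word of some length is `≠ 1` in `Perm Ray` (`ne_one_of_moves`) — never '= 1 by a
finite level'.  The identities the census also needs ((ad)⁴ = 1, (ac)⁸ = 1, the Klein table) are proved elsewhere by sections, not here.
* §1 `evalPerm` (a word in p590723's `Letter`s as an element of `Perm Ray`); the model `modelA`, `modelT j` (the `b, c, d` family along the spine,
  `j mod 3`), `Letter.model`, `evalModel`, `Letter.isTree/isBC`; `trunc n x` (the first `n` letters of a ray), `pad u` (the ray `u 1^∞`).
* §2 THE BRIDGE `trunc_evalPerm : trunc n (evalPerm w x) = evalModel w (trunc n x)` (𝔊 acts by tree automorphisms: level `n` is preserved and the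
  model is its action), from p590401's `genA_cons`, `genB_cons_true`, … .
* §3 `ne_one_of_moves`, `ne_of_evalModel_ne`; §4 the two certified tables `alt8_ne_one` (x₁ a x₂ a x₃ a x₄ a ≠ 1 for x₁ ∈ {b,c}, xᵢ ∈ {b,c,d};
  witnesses `0000`, `0100`) and `alt16_ne_one` (b a x₂ a ⋯ x₈ a ≠ 1 for xᵢ ∈ {b,c}; witness `10000`) — `decide` on explicit finite data at levels 4 and 5.
[cite: Grigorchuk1980, definition of a, b, c, d] [cite: BartholdiErschler2012, §3.1 (wreath recursion)]
-/

namespace Summit.CriticalPhenomena.PercolationContinuityZ3.Theorems.Transplant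

namespace Grigorchuk

/-! ### §1 Words, the finite model, truncation -/

/-- A word (in the letters `Letter` of «GrigorchukNormalForms» p590723: `a` and `x b, x c, x d`) as an element of `Perm Ray`: the product
`x₁ x₂ ⋯ x_k` (so it ACTS as `x₁ ∘ x₂ ∘ ⋯ ∘ x_k`; the same expression as in `eval_nf` there). [folklore] -/
noncomputable def evalPerm (w : List Letter) : Equiv.Perm Ray := (w.map Letter.toPerm).prod

/-- `evalPerm [] = 1`. [folklore] -/
@[simp] theorem evalPerm_nil : evalPerm [] = 1 := rfl

/-- `evalPerm (x :: w) = x.toPerm * evalPerm w`. [folklore] -/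
theorem evalPerm_cons (x : Letter) (w : List Letter) : evalPerm (x :: w) = x.toPerm * evalPerm w := by
  unfold evalPerm; rw [List.map_cons, List.prod_cons]

/-- The model of `a` on finite words: flip the first letter. [cite: Grigorchuk1980, definition of a] -/
def modelA : List Bool → List Bool
  | [] => []
  | i :: w => (!i) :: w

/-- The model of the `b, c, d` family along the spine: `modelT j` is `b, c, d` for `j ≡ 0, 1, 2 (mod 3)`; on `1·w` it recurses with `j+1`, on `0·w` it
applies `a` to `w` unless `j ≡ 2`. [cite: BartholdiErschler2012, §3.1 (wreath recursion b = (a,c), c = (a,d), d = (1,b))] -/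
def modelT : ℕ → List Bool → List Bool
  | _, [] => []
  | j, true :: w => true :: modelT (j + 1) w
  | j, false :: w => false :: (if j % 3 = 2 then w else modelA w)

/-- The model of a letter. [folklore] -/
def Letter.model : Letter → List Bool → List Bool
  | .a => modelA
  | .x .b => modelT 0
  | .x .c => modelT 1
  | .x .d => modelT 2

/-- The model of a word (acting as `x₁ ∘ ⋯ ∘ x_k`, like `evalPerm`). [folklore] -/
def evalModel : List Letter → List Bool → List Bool
  | [], u => u
  | x :: w, u => x.model (evalModel w u)

/-- The first `n` letters of a ray. [folklore] -/
def trunc (n : ℕ) (x : Ray) : List Bool := (List.range n).map x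

/-- The ray `u 1^∞`. [folklore] -/
def pad : List Bool → Ray
  | [] => rho
  | i :: u => cons i (pad u)

/-- `trunc 0 x = []`. [folklore] -/
@[simp] theorem trunc_zero (x : Ray) : trunc 0 x = [] := rfl

/-- `trunc (n+1) (i·y) = i :: trunc n y`. [folklore] -/
theorem trunc_succ_cons (n : ℕ) (i : Bool) (y : Ray) : trunc (n + 1) (cons i y) = i :: trunc n y := by
  unfold trunc
  rw [List.range_succ_eq_map, List.map_cons, List.map_map, cons_zero]
  congr 1

/-- `trunc (n+1) x = x₀ :: trunc n (tail x)`. [folklore] -/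
theorem trunc_succ (n : ℕ) (x : Ray) : trunc (n + 1) x = x 0 :: trunc n (tail x) := by
  conv_lhs => rw [← cons_head_tail x]
  exact trunc_succ_cons n (x 0) (tail x)

/-- `trunc |u| (u 1^∞) = u`. [folklore] -/
theorem trunc_pad (u : List Bool) : trunc u.length (pad u) = u := by
  induction u with
  | nil => rfl
  | cons i u ih => rw [List.length_cons, pad, trunc_succ_cons, ih]

/-! ### §2 The bridge: the model computes the truncation of the true action -/

/-- The `b, c, d` family as permutations: `genT j = genB, genC, genD` for `j ≡ 0, 1, 2 (mod 3)`. [folklore] -/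
noncomputable def genT (j : ℕ) : Equiv.Perm Ray := if j % 3 = 0 then genB else if j % 3 = 1 then genC else genD

/-- `genT j = b` for `j ≡ 0`. [folklore] -/
theorem genT_of_mod0 {j : ℕ} (h : j % 3 = 0) : genT j = genB := by unfold genT; rw [h]; rfl

/-- `genT j = c` for `j ≡ 1`. [folklore] -/
theorem genT_of_mod1 {j : ℕ} (h : j % 3 = 1) : genT j = genC := by unfold genT; rw [h]; rfl

/-- `genT j = d` for `j ≡ 2`. [folklore] -/
theorem genT_of_mod2 {j : ℕ} (h : j % 3 = 2) : genT j = genD := by unfold genT; rw [h]; rfl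

/-- On `1·y`: `genT j (1·y) = 1·(genT (j+1) y)` (`b ↦ c ↦ d ↦ b`). [cite: BartholdiErschler2012, §3.1] -/
theorem genT_cons_true (j : ℕ) (y : Ray) : genT j (cons true y) = cons true (genT (j + 1) y) := by
  have h3 : j % 3 = 0 ∨ j % 3 = 1 ∨ j % 3 = 2 := by omega
  rcases h3 with h | h | h
  · rw [genT_of_mod0 h, genT_of_mod1 (by omega), genB_cons_true]
  · rw [genT_of_mod1 h, genT_of_mod2 (by omega), genC_cons_true]
  · rw [genT_of_mod2 h, genT_of_mod0 (by omega), genD_cons_true]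

/-- On `0·y`: `genT j (0·y) = 0·(a y)` unless `j ≡ 2`, when it is `0·y`. [cite: BartholdiErschler2012, §3.1] -/
theorem genT_cons_false (j : ℕ) (y : Ray) : genT j (cons false y) = cons false (if j % 3 = 2 then y else genA y) := by
  have h3 : j % 3 = 0 ∨ j % 3 = 1 ∨ j % 3 = 2 := by omega
  rcases h3 with h | h | h
  · rw [genT_of_mod0 h, if_neg (by omega), genB_cons_false]
  · rw [genT_of_mod1 h, if_neg (by omega), genC_cons_false]
  · rw [genT_of_mod2 h, if_pos h, genD_cons_false]

/-- Bridge for `a`. [folklore] -/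
theorem trunc_genA (n : ℕ) (x : Ray) : trunc n (genA x) = modelA (trunc n x) := by
  cases n with
  | zero => rfl
  | succ n =>
    conv_lhs => rw [← cons_head_tail x, genA_cons]
    rw [trunc_succ_cons, trunc_succ]
    rfl

/-- Bridge for the `b, c, d` family. [folklore] -/
theorem trunc_genT (n : ℕ) : ∀ (j : ℕ) (x : Ray), trunc n (genT j x) = modelT j (trunc n x) := by
  induction n with
  | zero => intro j x; rfl
  | succ n ih =>
    intro j x
    rw [trunc_succ n x]
    conv_lhs => rw [← cons_head_tail x]
    cases x 0
    · rw [genT_cons_false, trunc_succ_cons]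
      show false :: trunc n (if j % 3 = 2 then tail x else genA (tail x)) =
        false :: (if j % 3 = 2 then trunc n (tail x) else modelA (trunc n (tail x)))
      split_ifs
      · rfl
      · rw [trunc_genA]
    · rw [genT_cons_true, trunc_succ_cons, ih]
      rfl

/-- Bridge for a letter. [folklore] -/
theorem trunc_toPerm (n : ℕ) (x : Letter) (y : Ray) : trunc n (x.toPerm y) = x.model (trunc n y) := by
  rcases x with _ | ⟨_ | _ | _⟩
  · exact trunc_genA n y
  · have := trunc_genT n 0 y; rw [genT_of_mod0 rfl] at this; exact this
  · have := trunc_genT n 1 y; rw [genT_of_mod1 rfl] at this; exact this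
  · have := trunc_genT n 2 y; rw [genT_of_mod2 rfl] at this; exact this

/-- **THE BRIDGE**: the finite model computes the level-`n` truncation of the action of a word. [folklore] -/
theorem trunc_evalPerm (n : ℕ) (w : List Letter) (y : Ray) : trunc n (evalPerm w y) = evalModel w (trunc n y) := by
  induction w with
  | nil => rfl
  | cons x w ih =>
    show trunc n (evalPerm (x :: w) y) = x.model (evalModel w (trunc n y))
    rw [evalPerm_cons, Equiv.Perm.mul_apply, trunc_toPerm, ih]

/-! ### §3 Non-identities from the model -/

/-- **A word whose model MOVES some finite binary word is not the identity of `Perm Ray`.** [folklore] -/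
theorem ne_one_of_moves {w : List Letter} {u : List Bool} (h : evalModel w u ≠ u) : evalPerm w ≠ 1 := by
  intro e
  apply h
  have := trunc_evalPerm u.length w (pad u)
  rwa [e, Equiv.Perm.coe_one, id, trunc_pad, eq_comm] at this

/-- Two words whose models differ on some finite binary word are different elements of `Perm Ray`. [folklore] -/
theorem ne_of_evalModel_ne {w w' : List Letter} {u : List Bool} (h : evalModel w u ≠ evalModel w' u) : evalPerm w ≠ evalPerm w' := by
  intro e
  apply h
  have h1 := trunc_evalPerm u.length w (pad u)
  have h2 := trunc_evalPerm u.length w' (pad u)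
  rw [trunc_pad] at h1 h2
  rw [← h1, ← h2, e]

/-! ### §4 The two certified tables for the label-rigidity census -/

/-- `x` is one of the tree letters `b, c, d` (Boolean test). [folklore] -/
def Letter.isTree : Letter → Bool
  | .a => false
  | .x _ => true

/-- `x` is one of the letters `b, c` (Boolean test). [folklore] -/
def Letter.isBC : Letter → Bool
  | .x .b => true
  | .x .c => true
  | _ => false

/-- The letters `b, c` indexed by `Bool`. [folklore] -/
def bcOf : Bool → Letter
  | false => .x .b
  | true => .x .c

/-- The letters `b, c, d` indexed by `Fin 3`. [folklore] -/
def bcdOf (i : Fin 3) : Letter := ![Letter.x .b, .x .c, .x .d] i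

/-- A `b/c` letter is some `bcOf`. [folklore] -/
theorem exists_bcOf_eq {x : Letter} (h : x.isBC = true) : ∃ i, bcOf i = x := by
  rcases x with _ | ⟨_ | _ | _⟩
  · exact absurd h (by decide)
  · exact ⟨false, rfl⟩
  · exact ⟨true, rfl⟩
  · exact absurd h (by decide)

/-- A tree letter is some `bcdOf`. [folklore] -/
theorem exists_bcdOf_eq {x : Letter} (h : x.isTree = true) : ∃ i, bcdOf i = x := by
  rcases x with _ | ⟨_ | _ | _⟩
  · exact absurd h (by decide)
  · exact ⟨0, rfl⟩
  · exact ⟨1, rfl⟩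
  · exact ⟨2, rfl⟩

/-- **The 54 alternating words of length 8 are non-identities**: `x₁ a x₂ a x₃ a x₄ a ≠ 1` in `𝔊` whenever `x₁ ∈ {b, c}` and `x₂, x₃, x₄ ∈ {b, c, d}`
(each moves the binary word `0000` or `0100`). [folklore] -/
theorem alt8_ne_one (x₁ x₂ x₃ x₄ : Letter) (h₁ : x₁.isBC = true) (h₂ : x₂.isTree = true) (h₃ : x₃.isTree = true)
    (h₄ : x₄.isTree = true) : evalPerm [x₁, .a, x₂, .a, x₃, .a, x₄, .a] ≠ 1 := by
  have key : ∀ (i₁ : Bool) (i₂ i₃ i₄ : Fin 3),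
      evalModel [bcOf i₁, .a, bcdOf i₂, .a, bcdOf i₃, .a, bcdOf i₄, .a] [false, false, false, false] ≠ [false, false, false, false] ∨
      evalModel [bcOf i₁, .a, bcdOf i₂, .a, bcdOf i₃, .a, bcdOf i₄, .a] [false, true, false, false] ≠ [false, true, false, false] := by
    decide
  obtain ⟨i₁, rfl⟩ := exists_bcOf_eq h₁
  obtain ⟨i₂, rfl⟩ := exists_bcdOf_eq h₂
  obtain ⟨i₃, rfl⟩ := exists_bcdOf_eq h₃
  obtain ⟨i₄, rfl⟩ := exists_bcdOf_eq h₄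
  rcases key i₁ i₂ i₃ i₄ with h | h <;> exact ne_one_of_moves h

/-- **The 128 alternating words of length 16 starting with `b` are non-identities**: `b a x₂ a ⋯ x₈ a ≠ 1` in `𝔊` whenever
`x₂, …, x₈ ∈ {b, c}` (each moves the binary word `10000`). [folklore] -/
theorem alt16_ne_one (x₂ x₃ x₄ x₅ x₆ x₇ x₈ : Letter) (h₂ : x₂.isBC = true) (h₃ : x₃.isBC = true) (h₄ : x₄.isBC = true)
    (h₅ : x₅.isBC = true) (h₆ : x₆.isBC = true) (h₇ : x₇.isBC = true) (h₈ : x₈.isBC = true) :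
    evalPerm [.x .b, .a, x₂, .a, x₃, .a, x₄, .a, x₅, .a, x₆, .a, x₇, .a, x₈, .a] ≠ 1 := by
  have key : ∀ i₂ i₃ i₄ i₅ i₆ i₇ i₈ : Bool,
      evalModel [.x .b, .a, bcOf i₂, .a, bcOf i₃, .a, bcOf i₄, .a, bcOf i₅, .a, bcOf i₆, .a, bcOf i₇, .a, bcOf i₈, .a]
        [true, false, false, false, false] ≠ [true, false, false, false, false] := by
    decide
  obtain ⟨i₂, rfl⟩ := exists_bcOf_eq h₂
  obtain ⟨i₃, rfl⟩ := exists_bcOf_eq h₃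
  obtain ⟨i₄, rfl⟩ := exists_bcOf_eq h₄
  obtain ⟨i₅, rfl⟩ := exists_bcOf_eq h₅
  obtain ⟨i₆, rfl⟩ := exists_bcOf_eq h₆
  obtain ⟨i₇, rfl⟩ := exists_bcOf_eq h₇
  obtain ⟨i₈, rfl⟩ := exists_bcOf_eq h₈
  exact ne_one_of_moves (key i₂ i₃ i₄ i₅ i₆ i₇ i₈)

end Grigorchuk

end Summit.CriticalPhenomena.PercolationContinuityZ3.Theorems.Transplant
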